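import Mathlib
import Literature.Combinatorics.Optimization.ReflectionRelations
import HarnessLib

/-!
# Huffman polytopes have extended formulations of size `O(n²)` (Kaibel–Pashkovich 2011, §4.2:
# Observation 1, Proposition 8, Corollary 2) — PROVED

Source: V. Kaibel, K. Pashkovich, *Constructing extended formulations from reflection relations*,
IPCO 2011, LNCS 6655, 287–300 [KaibelPashkovich2011] (held text `paper:arxiv-1011.3597`, §4.2, arXiv
pp. 11–12). Verbatim (p. 11): "A vector `v ∈ ℝⁿ` (with `n ≥ 2`) is a *Huffman-vector* if there is a
rooted binary tree with `n` leaves (all non-leaf nodes having two children) and a labeling of the leaves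
by `1, …, n` such that, for each `i ∈ [n]`, the number of arcs on the path from the root to the leaf
labelled `i` equals `v_i`. Let us denote by `V^n_huff` the set of all Huffman-vectors in `ℝⁿ`, and by
`P^n_huff = conv(V^n_huff)` the *Huffman polytope*. … **Observation 1.** 1. For each `γ ∈ 𝔖(n)`, we have
`γ.V^n_huff = V^n_huff`. 2. For each `v ∈ V^n_huff` there are at least two components of `v` equal to
`max{v_k : k ∈ [n]}`. 3. For each `v ∈ V^n_huff` (`n ≥ 3`) and `v_i = v_j = max{v_k : k ∈ [n]}` for some
pair `i < j`, we have `(v_1, …, v_{i−1}, v_i − 1, v_{i+1}, …, v_{j−1}, v_{j+1}, …, v_n) ∈ V^{n−1}_huff`.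
4. For each `w' ∈ V^{n−1}_huff` (`n ≥ 3`), we have `(w'_1, …, w'_{n−2}, w'_{n−1} + 1, w'_{n−1} + 1) ∈
V^n_huff`. For `n ≥ 3`, let us define the embedding `P^{n−1} = {(x_1, …, x_{n−2}, x_{n−1} + 1, x_{n−1} + 1)
: (x_1, …, x_{n−1}) ∈ P^{n−1}_huff}` of `P^{n−1}_huff` into `ℝⁿ`. **Proposition 8.** Let `𝓡 ⊆ ℝⁿ × ℝⁿ`
be the polyhedral relation that is induced by the following sequence of transposition relations:
`T_{n−2,n−1}, T_{n−3,n−2}, …, T_{2,3}, T_{1,2}, T_{n−1,n}, T_{n−2,n−1}, …, T_{2,3}, T_{1,2}` (4). Then we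
have `𝓡(P^{n−1}) = P^n_huff`. *Proof.* With `P = P^{n−1}` and `Q = P^n_huff`, the first condition of
Theorem 1 is obviously satisfied (due to parts (1) and (4) of Observation 1). We have `Q = conv(W)` with
`W = V^n_huff`. Furthermore, for every `w ∈ W` and `x = τ*(w)` with `τ* = τ*_{n−2,n−1} ∘ ⋯ ∘ τ*_{1,2} ∘
τ*_{n−1,n} ∘ ⋯ ∘ τ*_{1,2}` (5), we have `x_n = x_{n−1} = max{w_i : i ∈ [n]}`, hence part (3) of
Observation 1 (with `i = n−1` and `j = n`) implies `τ*(w) ∈ P^{n−1}`. Therefore, the claim follows by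
Theorem 1." (p. 12): "From Remark 2 we thus obtain an extended formulation for `P^n_huff` with
`n' + 2n − 3` variables and `f' + 4n − 6` inequalities, provided we have an extended formulation for
`P^{n−1}_huff` with `n'` variables and `f'` inequalities. As `P^2_huff` is a single point, we thus can
establish inductively the following result. **Corollary 2.** There are extended formulations of
`P^n_huff` with `O(n²)` variables and inequalities."

## What is proved (no named fact)

On top of the tree's reflection-relation machinery (`ReflectionRelations.lean`: `seqImage`, `canonSeq`,
`KaibelPashkovich2011_thm1`, `transVec`/`transSeq` (transposition relations of a comparator network),
`canonSeq_transSeq : canonSeq (transSeq N) y = N.apply y`, `HasEFOfSize.seqImage`) and the bubbling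
passes of `PermutahedronSortingNetworkEF.lean` (`ComparatorNetwork.bubblePass`, `bubblePass_spec`):

* `Huffman.BTree` (rooted binary trees, every non-leaf node with two children), `BTree.depths` (the
  multiset of the numbers of arcs from the root to the leaves), `IsHuffmanVec v` for `v : Fin n → ℕ`
  (the multiset of components of `v` is the leaf-depth multiset of such a tree with `n` leaves — this IS
  "a labeling of the leaves by `1, …, n` with depth(leaf `i`) = `v_i`", a labeling being a bijection
  between `[n]` and the leaves), `huffVecs n ⊆ ℝⁿ` (`V^n_huff`), `huffPoly n = conv(huffVecs n)`;
* **Observation 1, all four parts, PROVED** (the paper: "It is easy to see"): (1)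
  `IsHuffmanVec.comp_perm`, `comp_perm_mem_huffVecs`; the tree surgeries `BTree.exists_split` (replace a
  leaf of depth `a` by a cherry: depths `− {a} + {a+1, a+1}`) and `BTree.exists_merge` (a deepest leaf has
  a leaf sibling: the maximal depth `d ≥ 1` occurs at least twice and contracting that cherry gives depths
  `− {d, d} + {d − 1}`); hence (2) `IsHuffmanVec.exists_two_max`, (3) `IsHuffmanVec.merge_last` (for the
  pair `(i, j) = (n−1, n)` used in the proof of Proposition 8; the general pair follows with (1)) and (4)
  `IsHuffmanVec.split_last`; also `huffVecs_one = {0}`, `huffVecs_two = {(1,1)}` ("`P^2_huff` is a single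
  point");
* `Huffman.embedAff m : ℝ^{m+1} →ᵃ ℝ^{m+2}`, `x ↦ (x_1, …, x_m, x_{m+1} + 1, x_{m+1} + 1)` and
  `embedPoly m = embedAff m '' huffPoly (m+1)` (the printed `P^{n−1}`, `n = m + 2`);
* `Huffman.huffNet m : ComparatorNetwork (m+2)` — the sequence (4)/(5) as a comparator network of the
  tree: the pass `(1,2), (2,3), …, (n−1,n)` followed by the pass `(1,2), …, (n−2,n−1)` (0-indexed:
  `bubblePass (m+1) ++ bubblePass m`; `transSeq` lists the relations in the printed order (4), the
  comparator applied first being the LAST relation), `length_huffNet = 2n − 3`;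
  `Huffman.apply_huffNet_last`/`apply_huffNet_penult` ("`x_n = x_{n−1} = max{w_i}`");
* **Proposition 8** `KaibelPashkovich2011_prop8 : seqImage (transSeq (huffNet m)) (embedPoly m) =
  huffPoly (m+2)` for every `m` (the paper assumes `n = m+2 ≥ 3`; `n = 2` is covered as well, with
  `P^1_huff = {0}`);
* **Corollary 2 with the printed recursion `f_n = f_{n−1} + 4n − 6`, `f_2 = 0`**:
  `KaibelPashkovich2011_cor2 : HasEFOfSize (huffPoly (m+2)) (2(m+2)m)`, i.e.
  `KaibelPashkovich2011_cor2' : 2 ≤ n → HasEFOfSize (huffPoly n) (2n(n−2))` — `xc(P^n_huff) ≤ 2n(n−2) =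
  O(n²)` in the tree's slack-form currency `Literature.Barriers.PneNP.HasEFOfSize` (size = number of
  inequalities; the variable count is not tracked by `HasEFOfSize`).

Deviations from print. (i) Huffman vectors are defined through the MULTISET of leaf depths (equal to the
multiset of components) instead of an explicit leaf labeling; the two are equivalent (a bijective
labeling transports one multiset onto the other and conversely equal finite multisets are matched by a
bijection), and every use in the paper goes through Observation 1, which is proved here from the tree
structure. The definition makes sense for `n = 1` (`V^1_huff = {(0)}`, the one-node tree), which the
paper excludes; nothing else changes. (ii) Observation 1 (3) is proved for the pair `(n−1, n)` (the case
the proof of Proposition 8 invokes); the general pair `i < j` reduces to it by (1). (iii) Corollary 2 is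
stated with the explicit count `2n(n−2)` produced by the printed recursion; Theorem 7 (`O(n log n)`,
"whose detailed proof will be included in the full version of the paper") is not formalised.
Honest framing: Literature infrastructure on extended formulations; nothing here bears on `P ≠ NP`.
-/

noncomputable section

namespace Literature.Combinatorics.Optimization

open Finset Literature.Barriers.PneNP

namespace Huffman

/-! ### Rooted binary trees and their leaf-depth multisets -/

/-- "a rooted binary tree … (all non-leaf nodes having two children)".
[cite: KaibelPashkovich2011, §4.2 (arXiv p. 11)] -/
inductive BTree : Type
  | leaf : BTree
  | node : BTree → BTree → BTree

namespace BTree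

/-- The multiset of leaf depths: "the number of arcs on the path from the root to the leaf", one entry
per leaf. [cite: KaibelPashkovich2011, §4.2 (arXiv p. 11)] -/
def depths : BTree → Multiset ℕ
  | leaf => {0}
  | node l r => (depths l + depths r).map (· + 1)

/-- The one-node tree has one leaf, of depth `0`. [cite: KaibelPashkovich2011, §4.2 (arXiv p. 11)] -/
@[simp] theorem depths_leaf : depths leaf = {0} := rfl

/-- The leaves of `node l r` are those of `l` and `r`, one arc deeper.
[cite: KaibelPashkovich2011, §4.2 (arXiv p. 11)] -/
@[simp] theorem depths_node (l r : BTree) : depths (node l r) = (depths l + depths r).map (· + 1) := rfl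

/-- Every tree has a leaf. [cite: KaibelPashkovich2011, §4.2 (arXiv p. 11)] -/
theorem card_depths_pos : ∀ t : BTree, 0 < Multiset.card t.depths
  | leaf => by simp
  | node l r => by
      rw [depths_node, Multiset.card_map, Multiset.card_add]
      exact Nat.add_pos_left (card_depths_pos l) _

/-- A tree with a non-leaf root has at least two leaves. [cite: KaibelPashkovich2011, §4.2 (arXiv p. 11)] -/
theorem two_le_card_depths_node (l r : BTree) : 2 ≤ Multiset.card (node l r).depths := by
  rw [depths_node, Multiset.card_map, Multiset.card_add]
  have := card_depths_pos l
  have := card_depths_pos r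
  omega

/-- In a tree with a non-leaf root every leaf has depth `≥ 1`. [cite: KaibelPashkovich2011, §4.2 (arXiv p. 11)] -/
theorem one_le_of_mem_depths_node {l r : BTree} {a : ℕ} (h : a ∈ (node l r).depths) : 1 ≤ a := by
  rw [depths_node, Multiset.mem_map] at h
  obtain ⟨b, -, rfl⟩ := h
  omega

/-- A tree with exactly one leaf is the one-node tree. [cite: KaibelPashkovich2011, §4.2 (arXiv p. 11)] -/
theorem eq_leaf_of_card_depths_le_one : ∀ {t : BTree}, Multiset.card t.depths ≤ 1 → t = leaf
  | leaf, _ => rfl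
  | node l r, h => absurd h (by have := two_le_card_depths_node l r; omega)

/-- A tree with exactly two leaves is the cherry: both leaves have depth `1` ("`P^2_huff` is a single
point"). [cite: KaibelPashkovich2011, §4.2 (arXiv p. 12)] -/
theorem depths_eq_of_card_eq_two : ∀ {t : BTree}, Multiset.card t.depths = 2 → t.depths = {1, 1}
  | leaf, h => by simp at h
  | node l r, h => by
      rw [depths_node, Multiset.card_map, Multiset.card_add] at h
      have hl : l = leaf := eq_leaf_of_card_depths_le_one (by have := card_depths_pos r; omega)
      have hr : r = leaf := eq_leaf_of_card_depths_le_one (by have := card_depths_pos l; omega)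
      subst hl; subst hr
      simp [depths]

/-- **Observation 1 (4), tree form**: replacing a leaf of depth `a` by a node with two leaf children turns
the depth multiset `D` into `(D − {a}) + {a+1, a+1}`. [cite: KaibelPashkovich2011, Observation 1 (4) (arXiv p. 11)] -/
theorem exists_split : ∀ (t : BTree) {a : ℕ}, a ∈ t.depths →
    ∃ t' : BTree, t'.depths = t.depths.erase a + {a + 1, a + 1}
  | leaf, a, h => by
      rw [depths_leaf, Multiset.mem_singleton] at h
      subst h
      exact ⟨node leaf leaf, by simp [depths]⟩
  | node l r, a, h => by
      classical
      rw [depths_node, Multiset.mem_map] at h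
      obtain ⟨b, hb, rfl⟩ := h
      have hinj : Function.Injective (fun x : ℕ => x + 1) := fun x y hxy => by simpa using hxy
      rcases Multiset.mem_add.1 hb with hbl | hbr
      · obtain ⟨l', hl'⟩ := exists_split l hbl
        refine ⟨node l' r, ?_⟩
        rw [depths_node, depths_node, hl']
        simp only [Multiset.map_add, Multiset.insert_eq_cons, Multiset.map_cons, Multiset.map_singleton]
        rw [Multiset.erase_add_left_pos _ (Multiset.mem_map_of_mem _ hbl)]
        simp only [Multiset.map_erase _ hinj]
        abel
      · obtain ⟨r', hr'⟩ := exists_split r hbr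
        refine ⟨node l r', ?_⟩
        rw [depths_node, depths_node, hr']
        simp only [Multiset.map_add, Multiset.insert_eq_cons, Multiset.map_cons, Multiset.map_singleton]
        rw [Multiset.erase_add_right_pos _ (Multiset.mem_map_of_mem _ hbr)]
        simp only [Multiset.map_erase _ hinj]
        abel

/-- The merging step when the maximal depth is attained in the LEFT subtree (auxiliary for
`exists_merge`). [cite: KaibelPashkovich2011, Observation 1 (2)–(3) (arXiv p. 11)] -/
private theorem merge_aux (l r : BTree) {e : ℕ}
    (ih : ∀ {d : ℕ}, d ∈ l.depths → (∀ x ∈ l.depths, x ≤ d) → 2 ≤ Multiset.card l.depths →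
      2 ≤ l.depths.count d ∧ 1 ≤ d ∧ ∃ t' : BTree, t'.depths = (l.depths.erase d).erase d + {d - 1})
    (he : e ∈ l.depths) (hbd : ∀ x ∈ l.depths + r.depths, x ≤ e) :
    2 ≤ (node l r).depths.count (e + 1) ∧ 1 ≤ e + 1 ∧
      ∃ t' : BTree, t'.depths = (((node l r).depths.erase (e + 1)).erase (e + 1)) + {e + 1 - 1} := by
  classical
  have hinj : Function.Injective (fun x : ℕ => x + 1) := fun x y hxy => by simpa using hxy
  cases l with
  | leaf =>
      rw [depths_leaf, Multiset.mem_singleton] at he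
      subst he
      cases r with
      | leaf =>
          refine ⟨by simp [depths], le_refl _, leaf, ?_⟩
          simp [depths]
      | node r₁ r₂ =>
          exfalso
          obtain ⟨x, hx⟩ := Multiset.card_pos_iff_exists_mem.1 (card_depths_pos (node r₁ r₂))
          have h1 := one_le_of_mem_depths_node hx
          have h2 := hbd x (Multiset.mem_add.2 (Or.inr hx))
          omega
  | node l₁ l₂ =>
      obtain ⟨hcount, he1, l', hl'⟩ := ih he (fun x hx => hbd x (Multiset.mem_add.2 (Or.inl hx)))
        (two_le_card_depths_node l₁ l₂)
      have hmem1 : e + 1 ∈ ((node l₁ l₂).depths).map (fun x : ℕ => x + 1) := Multiset.mem_map_of_mem _ he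
      have hcount1 : 2 ≤ (((node l₁ l₂).depths).map (fun x : ℕ => x + 1)).count (e + 1) := by
        rw [Multiset.count_map_eq_count' _ _ hinj]; exact hcount
      have hmem2 : e + 1 ∈ ((((node l₁ l₂).depths).map (fun x : ℕ => x + 1)).erase (e + 1)) := by
        rw [← Multiset.count_pos, Multiset.count_erase_self]; omega
      refine ⟨?_, by omega, node l' r, ?_⟩
      · rw [depths_node, Multiset.map_add, Multiset.count_add]
        exact le_add_right hcount1
      · rw [depths_node, depths_node (node l₁ l₂) r, hl', Multiset.map_add, Multiset.map_add, Multiset.map_add,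
          Multiset.erase_add_left_pos _ hmem1, Multiset.erase_add_left_pos _ hmem2,
          Multiset.map_erase _ hinj, Multiset.map_erase _ hinj, Multiset.map_singleton,
          Nat.sub_add_cancel he1, Nat.add_sub_cancel]
        abel

/-- **Observation 1 (2) and (3), tree form**: in a tree with at least two leaves the maximal leaf depth
`d` is `≥ 1` and occurs at least twice (a deepest leaf has a leaf sibling), and contracting such a pair
of sibling leaves turns the depth multiset `D` into `(D − {d, d}) + {d − 1}`.
[cite: KaibelPashkovich2011, Observation 1 (2)–(3) (arXiv p. 11)] -/
theorem exists_merge : ∀ (t : BTree) {d : ℕ}, d ∈ t.depths → (∀ x ∈ t.depths, x ≤ d) →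
    2 ≤ Multiset.card t.depths →
    2 ≤ t.depths.count d ∧ 1 ≤ d ∧ ∃ t' : BTree, t'.depths = (t.depths.erase d).erase d + {d - 1}
  | leaf, d, _, _, h2 => by simp at h2
  | node l r, d, hd, hbd, _ => by
      classical
      rw [depths_node, Multiset.mem_map] at hd
      obtain ⟨e, he, rfl⟩ := hd
      have hbd' : ∀ x ∈ l.depths + r.depths, x ≤ e := fun x hx => by
        have := hbd (x + 1) (by rw [depths_node]; exact Multiset.mem_map_of_mem _ hx)
        omega
      rcases Multiset.mem_add.1 he with hel | her
      · exact merge_aux l r (fun hd hb hc => exists_merge l hd hb hc) hel hbd'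
      · have hswap : (node l r).depths = (node r l).depths := by
          rw [depths_node, depths_node, add_comm]
        rw [hswap]
        exact merge_aux r l (fun hd hb hc => exists_merge r hd hb hc) her
          (fun x hx => hbd' x (by rw [add_comm]; exact hx))

end BTree

/-! ### Huffman vectors and the Huffman polytope -/

variable {n : ℕ}

/-- **Huffman vector**: `v ∈ ℕⁿ` such that some rooted binary tree with `n` leaves (all non-leaf nodes
with two children) has a labeling of its leaves by `[n]` with depth(leaf `i`) `= v_i` — equivalently (our
definition) the multiset `{v_1, …, v_n}` is the leaf-depth multiset of such a tree.
[cite: KaibelPashkovich2011, §4.2 (arXiv p. 11)] -/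
def IsHuffmanVec (v : Fin n → ℕ) : Prop :=
  ∃ t : BTree, t.depths = (univ : Finset (Fin n)).val.map v

/-- `V^n_huff ⊆ ℝⁿ`, "the set of all Huffman-vectors in `ℝⁿ`". [cite: KaibelPashkovich2011, §4.2 (arXiv p. 11)] -/
def huffVecs (n : ℕ) : Set (Fin n → ℝ) :=
  {x | ∃ v : Fin n → ℕ, IsHuffmanVec v ∧ x = fun i => (v i : ℝ)}

/-- The **Huffman polytope** `P^n_huff = conv(V^n_huff)`. [cite: KaibelPashkovich2011, §4.2 (arXiv p. 11)] -/
def huffPoly (n : ℕ) : Set (Fin n → ℝ) := convexHull ℝ (huffVecs n)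

/-- The multiset of components, split off at the last coordinate. [cite: KaibelPashkovich2011, Observation 1 (arXiv p. 11)] -/
theorem univ_val_map_succ {α : Type*} {k : ℕ} (f : Fin (k + 1) → α) :
    (univ : Finset (Fin (k + 1))).val.map f =
      (univ : Finset (Fin k)).val.map (f ∘ Fin.castSucc) + {f (Fin.last k)} := by
  rw [Fin.univ_val_map, Fin.univ_val_map, List.ofFn_succ', List.concat_eq_append, ← Multiset.coe_add,
    Multiset.coe_singleton]
  rfl

/-- **Observation 1 (1)**: `γ.V^n_huff = V^n_huff` for `γ ∈ 𝔖(n)` (relabel the leaves).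
[cite: KaibelPashkovich2011, Observation 1 (1) (arXiv p. 11)] -/
theorem IsHuffmanVec.comp_perm {v : Fin n → ℕ} (hv : IsHuffmanVec v) (σ : Equiv.Perm (Fin n)) :
    IsHuffmanVec (v ∘ ⇑σ) := by
  obtain ⟨t, ht⟩ := hv
  refine ⟨t, ?_⟩
  rw [ht, ← Multiset.map_map, Multiset.map_univ_val_equiv]

/-- **Observation 1 (1)** on `V^n_huff ⊆ ℝⁿ`. [cite: KaibelPashkovich2011, Observation 1 (1) (arXiv p. 11)] -/
theorem comp_perm_mem_huffVecs {x : Fin n → ℝ} (hx : x ∈ huffVecs n) (σ : Equiv.Perm (Fin n)) :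
    x ∘ ⇑σ ∈ huffVecs n := by
  obtain ⟨v, hv, rfl⟩ := hx
  exact ⟨v ∘ ⇑σ, hv.comp_perm σ, rfl⟩

/-- **Observation 1 (2)**: a Huffman vector with `n ≥ 2` components has two distinct components equal
to its maximum. [cite: KaibelPashkovich2011, Observation 1 (2) (arXiv p. 11)] -/
theorem IsHuffmanVec.exists_two_max {v : Fin n → ℕ} (hv : IsHuffmanVec v) (hn : 2 ≤ n) :
    ∃ i j : Fin n, i ≠ j ∧ v j = v i ∧ ∀ k, v k ≤ v i := by
  classical
  obtain ⟨t, ht⟩ := hv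
  have hne : (univ : Finset (Fin n)).Nonempty :=
    Finset.univ_nonempty_iff.2 (Fin.pos_iff_nonempty.1 (by omega))
  obtain ⟨i₀, -, hi₀⟩ := Finset.exists_max_image univ v hne
  have hmem : v i₀ ∈ t.depths := by rw [ht]; exact Multiset.mem_map_of_mem _ (Finset.mem_univ_val _)
  have hbd : ∀ x ∈ t.depths, x ≤ v i₀ := by
    intro x hx
    rw [ht, Multiset.mem_map] at hx
    obtain ⟨k, -, rfl⟩ := hx
    exact hi₀ k (mem_univ k)
  have hcard : 2 ≤ Multiset.card t.depths := by rw [ht, Multiset.card_map]; simpa using hn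
  obtain ⟨hcount, -, -⟩ := t.exists_merge hmem hbd hcard
  rw [ht, Multiset.count_map] at hcount
  have hcount' : 1 < (univ.filter fun k => v i₀ = v k).card := by
    rw [Finset.card_def, Finset.filter_val]
    omega
  obtain ⟨i, hi, j, hj, hij⟩ := Finset.one_lt_card.1 hcount'
  rw [Finset.mem_filter] at hi hj
  refine ⟨i, j, hij, by rw [← hi.2, ← hj.2], fun k => ?_⟩
  rw [← hi.2]; exact hi₀ k (mem_univ k)

/-- **Observation 1 (3)** for the pair `(i, j) = (n−1, n)` (here `n = m + 2`, 0-indexed positions `m` and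
`m + 1`): if the last two components of a Huffman vector both equal its maximum, dropping the last one
and decreasing the other by one gives a Huffman vector with `n − 1` components.
[cite: KaibelPashkovich2011, Observation 1 (3) (arXiv p. 11)] -/
theorem IsHuffmanVec.merge_last {m : ℕ} {v : Fin (m + 2) → ℕ} (hv : IsHuffmanVec v)
    (heq : v (Fin.last (m + 1)) = v (Fin.castSucc (Fin.last m)))
    (hmax : ∀ k, v k ≤ v (Fin.castSucc (Fin.last m))) :
    1 ≤ v (Fin.castSucc (Fin.last m)) ∧
      IsHuffmanVec (Function.update (v ∘ Fin.castSucc) (Fin.last m) (v (Fin.castSucc (Fin.last m)) - 1)) := by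
  classical
  obtain ⟨t, ht⟩ := hv
  set d := v (Fin.castSucc (Fin.last m)) with hd
  have hmem : d ∈ t.depths := by rw [ht]; exact Multiset.mem_map_of_mem _ (Finset.mem_univ_val _)
  have hbd : ∀ x ∈ t.depths, x ≤ d := by
    intro x hx
    rw [ht, Multiset.mem_map] at hx
    obtain ⟨k, -, rfl⟩ := hx
    exact hmax k
  have hcard : 2 ≤ Multiset.card t.depths := by rw [ht, Multiset.card_map]; simp
  obtain ⟨-, hd1, t', ht'⟩ := t.exists_merge hmem hbd hcard
  refine ⟨hd1, t', ?_⟩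
  have hsplit : (univ : Finset (Fin (m + 2))).val.map v =
      (univ : Finset (Fin m)).val.map (v ∘ Fin.castSucc ∘ Fin.castSucc) + {d} + {d} := by
    rw [univ_val_map_succ, univ_val_map_succ, heq]; rfl
  have hsplit' : (univ : Finset (Fin (m + 1))).val.map
        (Function.update (v ∘ Fin.castSucc) (Fin.last m) (d - 1)) =
      (univ : Finset (Fin m)).val.map (v ∘ Fin.castSucc ∘ Fin.castSucc) + {d - 1} := by
    rw [univ_val_map_succ, Function.update_self]
    congr 1
    refine Multiset.map_congr rfl fun k _ => ?_
    simp only [Function.comp_apply]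
    rw [Function.update_of_ne (Fin.castSucc_lt_last k).ne]
    rfl
  rw [ht', ht, hsplit, hsplit', Multiset.erase_add_right_pos _ (Multiset.mem_singleton_self d),
    Multiset.erase_singleton, add_zero, Multiset.erase_add_right_pos _ (Multiset.mem_singleton_self d),
    Multiset.erase_singleton, add_zero]

/-- The integer embedding `w' ↦ (w'_1, …, w'_{n−2}, w'_{n−1} + 1, w'_{n−1} + 1)`.
[cite: KaibelPashkovich2011, Observation 1 (4) (arXiv p. 11)] -/
def splitLast {m : ℕ} (w : Fin (m + 1) → ℕ) : Fin (m + 2) → ℕ :=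
  Fin.snoc (Function.update w (Fin.last m) (w (Fin.last m) + 1)) (w (Fin.last m) + 1)

/-- **Observation 1 (4)**: `(w'_1, …, w'_{n−2}, w'_{n−1} + 1, w'_{n−1} + 1) ∈ V^n_huff` for
`w' ∈ V^{n−1}_huff`. [cite: KaibelPashkovich2011, Observation 1 (4) (arXiv p. 11)] -/
theorem IsHuffmanVec.split_last {m : ℕ} {w : Fin (m + 1) → ℕ} (hw : IsHuffmanVec w) :
    IsHuffmanVec (splitLast w) := by
  classical
  obtain ⟨t, ht⟩ := hw
  set a := w (Fin.last m) with ha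
  have hmem : a ∈ t.depths := by rw [ht]; exact Multiset.mem_map_of_mem _ (Finset.mem_univ_val _)
  obtain ⟨t', ht'⟩ := t.exists_split hmem
  refine ⟨t', ?_⟩
  have h1 : (univ : Finset (Fin (m + 1))).val.map w =
      (univ : Finset (Fin m)).val.map (w ∘ Fin.castSucc) + {a} := univ_val_map_succ w
  have h2 : (univ : Finset (Fin (m + 2))).val.map (splitLast w) =
      (univ : Finset (Fin m)).val.map (w ∘ Fin.castSucc) + {a + 1} + {a + 1} := by
    rw [univ_val_map_succ, univ_val_map_succ]
    simp only [splitLast, Fin.snoc_last, Function.comp_def, Fin.snoc_castSucc, Function.update_self]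
    congr 2
    refine Multiset.map_congr rfl fun k _ => ?_
    rw [Function.update_of_ne (Fin.castSucc_lt_last k).ne]
  rw [ht', ht, h1, h2, Multiset.erase_add_right_pos _ (Multiset.mem_singleton_self a),
    Multiset.erase_singleton, add_zero, Multiset.insert_eq_cons, ← Multiset.singleton_add, add_assoc]

/-- `V^1_huff = {(0)}` (the one-node tree). [cite: KaibelPashkovich2011, §4.2 (arXiv p. 11)] -/
theorem isHuffmanVec_one_iff (v : Fin 1 → ℕ) : IsHuffmanVec v ↔ v 0 = 0 := by
  constructor
  · rintro ⟨t, ht⟩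
    have hcard : Multiset.card t.depths ≤ 1 := by rw [ht, Multiset.card_map]; simp
    have := BTree.eq_leaf_of_card_depths_le_one hcard
    subst this
    have h0 : v 0 ∈ BTree.leaf.depths := by rw [ht]; exact Multiset.mem_map_of_mem _ (Finset.mem_univ_val _)
    simpa using h0
  · intro h
    refine ⟨BTree.leaf, ?_⟩
    rw [univ_val_map_succ]
    simp [h]

/-- `V^2_huff = {(1,1)}` ("`P^2_huff` is a single point"). [cite: KaibelPashkovich2011, §4.2 (arXiv p. 12)] -/
theorem isHuffmanVec_two_iff (v : Fin 2 → ℕ) : IsHuffmanVec v ↔ v 0 = 1 ∧ v 1 = 1 := by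
  constructor
  · rintro ⟨t, ht⟩
    have hcard : Multiset.card t.depths = 2 := by rw [ht, Multiset.card_map]; simp
    have h11 := BTree.depths_eq_of_card_eq_two hcard
    have h0 : v 0 ∈ t.depths := by rw [ht]; exact Multiset.mem_map_of_mem _ (Finset.mem_univ_val _)
    have h1 : v 1 ∈ t.depths := by rw [ht]; exact Multiset.mem_map_of_mem _ (Finset.mem_univ_val _)
    rw [h11] at h0 h1
    simp only [Multiset.insert_eq_cons, Multiset.mem_cons, Multiset.mem_singleton, or_self] at h0 h1
    exact ⟨h0, h1⟩
  · rintro ⟨h0, h1⟩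
    refine ⟨BTree.node BTree.leaf BTree.leaf, ?_⟩
    rw [univ_val_map_succ, univ_val_map_succ]
    simp [BTree.depths, Function.comp_def, h0, h1]

/-- `V^1_huff = {0} ⊆ ℝ¹`. [cite: KaibelPashkovich2011, §4.2 (arXiv p. 11)] -/
theorem huffVecs_one : huffVecs 1 = {0} := by
  ext x
  simp only [huffVecs, Set.mem_setOf_eq, Set.mem_singleton_iff, isHuffmanVec_one_iff]
  constructor
  · rintro ⟨v, hv, rfl⟩
    funext i
    rw [Subsingleton.elim i 0, hv]; simp
  · rintro rfl
    exact ⟨fun _ => 0, rfl, funext fun i => by simp⟩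

/-- `V^2_huff = {(1,1)} ⊆ ℝ²`. [cite: KaibelPashkovich2011, §4.2 (arXiv p. 12)] -/
theorem huffVecs_two : huffVecs 2 = {fun _ => 1} := by
  ext x
  simp only [huffVecs, Set.mem_setOf_eq, Set.mem_singleton_iff, isHuffmanVec_two_iff]
  constructor
  · rintro ⟨v, ⟨h0, h1⟩, rfl⟩
    funext i
    fin_cases i
    · simp [h0]
    · simp [h1]
  · rintro rfl
    exact ⟨fun _ => 1, ⟨rfl, rfl⟩, funext fun i => by simp⟩

/-- `P^1_huff = {0}`. [cite: KaibelPashkovich2011, §4.2 (arXiv p. 11)] -/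
theorem huffPoly_one : huffPoly 1 = {0} := by
  rw [huffPoly, huffVecs_one, convexHull_singleton]

/-- "`P^2_huff` is a single point." [cite: KaibelPashkovich2011, §4.2 (arXiv p. 12)] -/
theorem huffPoly_two : huffPoly 2 = {fun _ => 1} := by
  rw [huffPoly, huffVecs_two, convexHull_singleton]

/-- A coordinate permutation of the generating set leaves the convex hull invariant (used for "`ϱ_{H_i}(Q) ⊆
Q`", the transposition case). [cite: KaibelPashkovich2011, Prop. 8, proof (arXiv p. 12: "the first condition of Theorem 1 is obviously satisfied")] -/
theorem comp_perm_mem_convexHull {W : Set (Fin n → ℝ)} (σ : Equiv.Perm (Fin n))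
    (hW : ∀ x ∈ W, x ∘ ⇑σ ∈ W) {x : Fin n → ℝ} (hx : x ∈ convexHull ℝ W) : x ∘ ⇑σ ∈ convexHull ℝ W := by
  have himg : (fun x : Fin n → ℝ => x ∘ ⇑σ) '' convexHull ℝ W =
      convexHull ℝ ((fun x : Fin n → ℝ => x ∘ ⇑σ) '' W) :=
    (LinearMap.funLeft ℝ ℝ ⇑σ).image_convexHull W
  have hsub : (fun x : Fin n → ℝ => x ∘ ⇑σ) '' W ⊆ W := by
    rintro _ ⟨y, hy, rfl⟩; exact hW y hy
  have : x ∘ ⇑σ ∈ (fun x : Fin n → ℝ => x ∘ ⇑σ) '' convexHull ℝ W := ⟨x, hx, rfl⟩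
  rw [himg] at this
  exact convexHull_mono hsub this

/-! ### The embedding `P^{n−1} ⊆ ℝⁿ` -/

/-- The index map `i ↦ min(i, m)` (coordinates `m` and `m+1` of `ℝ^{m+2}` both read coordinate `m` of
`ℝ^{m+1}`). [cite: KaibelPashkovich2011, §4.2 (arXiv p. 11, definition of `P^{n−1}`)] -/
def collapse (m : ℕ) (i : Fin (m + 2)) : Fin (m + 1) := ⟨min (i : ℕ) m, by omega⟩

/-- The shift `e_{n−1} + e_n` (0-indexed: coordinates `m`, `m+1`). [cite: KaibelPashkovich2011, §4.2 (arXiv p. 11, definition of `P^{n−1}`)] -/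
def shiftVec (m : ℕ) : Fin (m + 2) → ℝ := fun i => if m ≤ (i : ℕ) then 1 else 0

/-- The affine embedding `(x_1, …, x_{n−1}) ↦ (x_1, …, x_{n−2}, x_{n−1} + 1, x_{n−1} + 1)` of `ℝ^{n−1}`
into `ℝⁿ` (`n = m + 2`). [cite: KaibelPashkovich2011, §4.2 (arXiv p. 11, definition of `P^{n−1}`)] -/
def embedAff (m : ℕ) : (Fin (m + 1) → ℝ) →ᵃ[ℝ] (Fin (m + 2) → ℝ) where
  toFun x := LinearMap.funLeft ℝ ℝ (collapse m) x + shiftVec m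
  linear := LinearMap.funLeft ℝ ℝ (collapse m)
  map_vadd' p v := by
    ext i
    simp only [vadd_eq_add, map_add, Pi.add_apply]
    ring

/-- Coordinates of the embedding. [cite: KaibelPashkovich2011, §4.2 (arXiv p. 11)] -/
theorem embedAff_apply (m : ℕ) (x : Fin (m + 1) → ℝ) (i : Fin (m + 2)) :
    embedAff m x i = x (collapse m i) + shiftVec m i := rfl

/-- The embedding as "linear map plus constant" (the shape of `HasEFOfSize.image_affine`).
[cite: KaibelPashkovich2011, §4.2 (arXiv p. 11)] -/
theorem embedAff_eq (m : ℕ) (x : Fin (m + 1) → ℝ) :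
    embedAff m x = LinearMap.funLeft ℝ ℝ (collapse m) x + shiftVec m := rfl

/-- On integer vectors the embedding is Observation 1 (4)'s map `splitLast`.
[cite: KaibelPashkovich2011, §4.2 (arXiv p. 11)] -/
theorem embedAff_natCast {m : ℕ} (w : Fin (m + 1) → ℕ) :
    embedAff m (fun i => (w i : ℝ)) = fun i => (splitLast w i : ℝ) := by
  funext i
  rw [embedAff_apply]
  simp only [splitLast, shiftVec, collapse]
  induction i using Fin.lastCases with
  | last =>
      simp only [Fin.val_last, Fin.snoc_last]
      rw [if_pos (by omega)]
      have : (⟨min (m + 1) m, by omega⟩ : Fin (m + 1)) = Fin.last m := Fin.ext (by simp)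
      rw [this]; push_cast; ring
  | cast j =>
      simp only [Fin.val_castSucc, Fin.snoc_castSucc]
      by_cases hj : j = Fin.last m
      · subst hj
        rw [Function.update_self, if_pos (by simp)]
        have : (⟨min ((Fin.last m : Fin (m + 1)) : ℕ) m, by omega⟩ : Fin (m + 1)) = Fin.last m :=
          Fin.ext (by simp)
        rw [this]; push_cast; ring
      · have hjm : (j : ℕ) < m := Fin.val_lt_last hj
        rw [Function.update_of_ne hj, if_neg (by omega)]
        have : (⟨min (j : ℕ) m, by omega⟩ : Fin (m + 1)) = j := Fin.ext (by simp [hjm.le])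
        rw [this, add_zero]

/-- `P^{n−1} = {(x_1, …, x_{n−2}, x_{n−1} + 1, x_{n−1} + 1) : x ∈ P^{n−1}_huff} ⊆ ℝⁿ` (`n = m + 2`).
[cite: KaibelPashkovich2011, §4.2 (arXiv p. 11)] -/
def embedPoly (m : ℕ) : Set (Fin (m + 2) → ℝ) := embedAff m '' huffPoly (m + 1)

/-- `P^{n−1} = conv(embedding of V^{n−1}_huff)`. [cite: KaibelPashkovich2011, §4.2 (arXiv p. 11)] -/
theorem embedPoly_eq (m : ℕ) : embedPoly m = convexHull ℝ (embedAff m '' huffVecs (m + 1)) := by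
  rw [embedPoly, huffPoly, AffineMap.image_convexHull]

/-- `P^{n−1}` is convex. [cite: KaibelPashkovich2011, §4.2 (arXiv p. 11)] -/
theorem convex_embedPoly (m : ℕ) : Convex ℝ (embedPoly m) := by
  rw [embedPoly_eq]; exact convex_convexHull ℝ _

/-- The embedded Huffman vectors are Huffman vectors (Observation 1 (4)).
[cite: KaibelPashkovich2011, Prop. 8, proof (arXiv p. 12: "due to parts (1) and (4) of Observation 1")] -/
theorem embedAff_image_huffVecs_subset (m : ℕ) : embedAff m '' huffVecs (m + 1) ⊆ huffVecs (m + 2) := by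
  rintro _ ⟨x, ⟨w, hw, rfl⟩, rfl⟩
  exact ⟨splitLast w, hw.split_last, embedAff_natCast w⟩

/-- "`P ⊆ Q`": `P^{n−1} ⊆ P^n_huff`. [cite: KaibelPashkovich2011, Prop. 8, proof (arXiv p. 12)] -/
theorem embedPoly_subset (m : ℕ) : embedPoly m ⊆ huffPoly (m + 2) := by
  rw [embedPoly_eq]
  exact convexHull_mono (embedAff_image_huffVecs_subset m)

/-- An extended formulation of `P^{n−1}_huff` gives one of `P^{n−1}` of the same size ("`n'` variables
and `f'` inequalities"). [cite: KaibelPashkovich2011, §4.2 (arXiv p. 12)] -/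
theorem hasEFOfSize_embedPoly {m r : ℕ} (h : HasEFOfSize (huffPoly (m + 1)) r) :
    HasEFOfSize (embedPoly m) r :=
  h.image_affine (LinearMap.funLeft ℝ ℝ (collapse m)) (shiftVec m)

/-! ### The sequence (4) as a comparator network, and "`x_n = x_{n−1} = max`" -/

/-- The sequence (4)/(5) as a comparator network of the tree (head comparator applied first, as `τ*`
applies `τ*_{1,2}` first): the pass `(1,2), (2,3), …, (n−1,n)` moving the maximum to coordinate `n`,
then the pass `(1,2), …, (n−2,n−1)` moving the maximum of the remaining coordinates to `n−1`
(0-indexed, `n = m + 2`). [cite: KaibelPashkovich2011, Prop. 8, eqs. (4)–(5) (arXiv pp. 11–12)] -/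
def huffNet (m : ℕ) : ComparatorNetwork (m + 2) :=
  ComparatorNetwork.bubblePass (m + 1) (by omega) ++ ComparatorNetwork.bubblePass m (by omega)

/-- The sequence has `(n−1) + (n−2) = 2n − 3` members. [cite: KaibelPashkovich2011, §4.2 (arXiv p. 12: "`n' + 2n − 3` variables and `f' + 4n − 6` inequalities")] -/
theorem length_huffNet (m : ℕ) : (huffNet m).length = 2 * m + 1 := by
  simp [huffNet]; ring

/-- After the two passes, coordinate `n` carries the maximum and coordinate `n−1` dominates the
coordinates `1, …, n−2`. [cite: KaibelPashkovich2011, Prop. 8, proof (arXiv p. 12: "`x_n = x_{n−1} = max{w_i : i ∈ [n]}`")] -/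
theorem apply_huffNet_spec {m : ℕ} (w : Fin (m + 2) → ℝ) :
    (∀ i : Fin (m + 2), (i : ℕ) < m →
        (huffNet m).apply w i ≤ (huffNet m).apply w (Fin.castSucc (Fin.last m))) ∧
      ∀ i : Fin (m + 2), (huffNet m).apply w i ≤ (huffNet m).apply w (Fin.last (m + 1)) := by
  rw [huffNet, ComparatorNetwork.apply_append]
  set y := (ComparatorNetwork.bubblePass (m + 1) (by omega : m + 1 < m + 2)).apply w with hy
  obtain ⟨h1, -, -⟩ := ComparatorNetwork.bubblePass_spec w (m + 1) (by omega : m + 1 < m + 2)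
  obtain ⟨h2, h3, h4⟩ := ComparatorNetwork.bubblePass_spec y m (by omega : m < m + 2)
  have hlast : (⟨m + 1, by omega⟩ : Fin (m + 2)) = Fin.last (m + 1) := rfl
  have hpen : (⟨m, by omega⟩ : Fin (m + 2)) = Fin.castSucc (Fin.last m) := rfl
  rw [← hy] at h1
  refine ⟨fun i hi => hpen ▸ h2 i hi, fun i => ?_⟩
  rw [h3 (Fin.last (m + 1)) (by simp)]
  by_cases hi : i = Fin.last (m + 1)
  · rw [hi, h3 (Fin.last (m + 1)) (by simp)]
  · have him : (i : ℕ) ≤ m := by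
      have := Fin.val_lt_last hi; omega
    obtain ⟨s', hs', hs⟩ := h4 i him
    rw [hs, ← hlast]
    exact h1 s' (by omega)

/-- For a Huffman vector `w` and `x = τ*(w)`: `x` is again a Huffman vector (a permutation of `w`) with
`x_n = x_{n−1} = max{w_i}` — in integer coordinates. [cite: KaibelPashkovich2011, Prop. 8, proof (arXiv p. 12)] -/
theorem exists_apply_huffNet_eq {m : ℕ} {w : Fin (m + 2) → ℝ} (hw : w ∈ huffVecs (m + 2)) :
    ∃ u : Fin (m + 2) → ℕ, IsHuffmanVec u ∧ ((huffNet m).apply w = fun i => (u i : ℝ)) ∧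
      u (Fin.last (m + 1)) = u (Fin.castSucc (Fin.last m)) ∧
      ∀ k, u k ≤ u (Fin.castSucc (Fin.last m)) := by
  obtain ⟨v, hv, rfl⟩ := hw
  obtain ⟨τ, hτ⟩ := ComparatorNetwork.exists_apply_eq_comp_perm (huffNet m) (fun i => (v i : ℝ))
  obtain ⟨hspec1, hspec2⟩ := apply_huffNet_spec (m := m) (fun i => (v i : ℝ))
  set x := (huffNet m).apply (fun i => (v i : ℝ)) with hx
  have hu : IsHuffmanVec (v ∘ ⇑τ) := hv.comp_perm τ
  have hxu : x = fun i => ((v ∘ ⇑τ) i : ℝ) := by rw [hτ]; rfl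
  set u := v ∘ ⇑τ with hu_def
  have hxk : ∀ k, x k = (u k : ℝ) := fun k => by rw [hxu]
  obtain ⟨i, j, hij, hji, hmax⟩ := hu.exists_two_max (by omega)
  -- `x_n` is the maximum
  have hlast : u (Fin.last (m + 1)) = u i := by
    refine le_antisymm (hmax _) ?_
    have := hspec2 i
    rw [hxk, hxk] at this
    exact_mod_cast this
  -- one of the two maximal positions is not `n`; it forces `x_{n−1} = max`
  have hpen : u (Fin.castSucc (Fin.last m)) = u i := by
    refine le_antisymm (hmax _) ?_
    obtain ⟨p, hp, hpu⟩ : ∃ p : Fin (m + 2), p ≠ Fin.last (m + 1) ∧ u p = u i := by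
      by_cases hi : i = Fin.last (m + 1)
      · exact ⟨j, fun h => hij (hi.trans h.symm), hji⟩
      · exact ⟨i, hi, rfl⟩
    by_cases hp' : p = Fin.castSucc (Fin.last m)
    · rw [← hp', hpu]
    · have hpm : (p : ℕ) < m := by
        have h1 := Fin.val_lt_last hp
        have h2 : (p : ℕ) ≠ m := fun h => hp' (Fin.ext (by simp [h]))
        omega
      have := hspec1 p hpm
      rw [hxk, hxk, hpu] at this
      exact_mod_cast this
  refine ⟨u, hu, hxu, hlast.trans hpen.symm, fun k => hpen ▸ hmax k⟩

/-- Undoing Observation 1 (3) by Observation 1 (4): if `u_n = u_{n−1} ≥ 1` then re-splitting the merged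
vector gives back `u`. [cite: KaibelPashkovich2011, Prop. 8, proof (arXiv p. 12: "implies `τ*(w) ∈ P^{n−1}`")] -/
theorem splitLast_merge {m : ℕ} {u : Fin (m + 2) → ℕ} (h1 : 1 ≤ u (Fin.castSucc (Fin.last m)))
    (heq : u (Fin.last (m + 1)) = u (Fin.castSucc (Fin.last m))) :
    splitLast (Function.update (u ∘ Fin.castSucc) (Fin.last m) (u (Fin.castSucc (Fin.last m)) - 1)) = u := by
  unfold splitLast
  rw [Function.update_self, Nat.sub_add_cancel h1, Function.update_idem]
  have hupd : Function.update (u ∘ Fin.castSucc) (Fin.last m) (u (Fin.castSucc (Fin.last m))) =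
      u ∘ Fin.castSucc := by
    rw [Function.update_eq_self_iff]; rfl
  rw [hupd, ← heq]
  exact Fin.snoc_init_self u

/-- "`τ*(w) ∈ P^{n−1}` for all `w ∈ W = V^n_huff`" (condition 2 of Theorem 1).
[cite: KaibelPashkovich2011, Prop. 8, proof (arXiv p. 12)] -/
theorem apply_huffNet_mem_embedPoly {m : ℕ} {w : Fin (m + 2) → ℝ} (hw : w ∈ huffVecs (m + 2)) :
    (huffNet m).apply w ∈ embedPoly m := by
  obtain ⟨u, hu, hx, heq, hmax⟩ := exists_apply_huffNet_eq hw
  obtain ⟨h1, hu'⟩ := hu.merge_last heq hmax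
  rw [hx, embedPoly_eq]
  refine subset_convexHull ℝ _ ⟨_, ⟨_, hu', rfl⟩, ?_⟩
  rw [embedAff_natCast, splitLast_merge h1 heq]

/-! ### Proposition 8 and Corollary 2 -/

/-- **KP11 Proposition 8.** The sequence of transposition relations (4) maps `P^{n−1}` onto the Huffman
polytope: `𝓡(P^{n−1}) = P^n_huff` (`n = m + 2`). [cite: KaibelPashkovich2011, Prop. 8 (arXiv pp. 11–12)] -/
theorem KaibelPashkovich2011_prop8 (m : ℕ) :
    seqImage (transSeq (huffNet m)) (embedPoly m) = huffPoly (m + 2) := by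
  apply KaibelPashkovich2011_thm1 (W := huffVecs (m + 2)) rfl (convex_embedPoly m) (embedPoly_subset m)
  · intro h hh
    obtain ⟨c, -, hne, rfl⟩ := mem_transSeq hh
    exact transVec_ne_zero hne
  · intro h hh x hx
    obtain ⟨c, -, hne, rfl⟩ := mem_transSeq hh
    dsimp only
    rw [reflectAt_transVec hne]
    exact comp_perm_mem_convexHull _ (fun y hy => comp_perm_mem_huffVecs hy _) hx
  · intro w hw
    rw [canonSeq_transSeq]
    exact apply_huffNet_mem_embedPoly hw

/-- The printed recursion: an EF of `P^{n−1}_huff` with `f'` inequalities gives one of `P^n_huff` with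
`f' + 4n − 6` inequalities (`n = m + 2`: `f' + 2(2m + 1)`). [cite: KaibelPashkovich2011, §4.2 (arXiv p. 12)] -/
theorem hasEFOfSize_huffPoly_step {m r : ℕ} (h : HasEFOfSize (huffPoly (m + 1)) r) :
    HasEFOfSize (huffPoly (m + 2)) (r + 2 * (2 * m + 1)) := by
  have h' := (hasEFOfSize_embedPoly h).seqImage (transSeq (huffNet m))
  rw [KaibelPashkovich2011_prop8] at h'
  have := length_transSeq_le (huffNet m)
  rw [length_huffNet] at this
  exact h'.of_le (by omega)

/-- **KP11 Corollary 2** with the printed count: starting from the point `P^2_huff` (`f_2 = 0`) the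
recursion `f_n = f_{n−1} + 4n − 6` gives `xc(P^n_huff) ≤ 2n(n − 2)` (`n = m + 2`).
[cite: KaibelPashkovich2011, Cor. 2 (arXiv p. 12)] -/
theorem KaibelPashkovich2011_cor2 : ∀ m : ℕ, HasEFOfSize (huffPoly (m + 2)) (2 * (m + 2) * m)
  | 0 => by
      rw [huffPoly_two]
      simpa using hasEFOfSize_singleton (fun _ : Fin 2 => (1 : ℝ))
  | m + 1 => by
      have h := hasEFOfSize_huffPoly_step (KaibelPashkovich2011_cor2 m)
      exact h.of_le (by nlinarith)

/-- **KP11 Corollary 2**: `xc(P^n_huff) ≤ 2n(n−2) = O(n²)` for every `n ≥ 2`.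
[cite: KaibelPashkovich2011, Cor. 2 (arXiv p. 12)] -/
theorem KaibelPashkovich2011_cor2' {n : ℕ} (hn : 2 ≤ n) : HasEFOfSize (huffPoly n) (2 * n * (n - 2)) := by
  obtain ⟨m, rfl⟩ : ∃ m, n = m + 2 := ⟨n - 2, by omega⟩
  simpa using KaibelPashkovich2011_cor2 m

end Huffman

end Literature.Combinatorics.Optimization

end
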